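import Summits.ValiantsHypothesis.ValiantsHypothesis.Theorems.NewtonFramesTwoProductsFrameRungTwoSymmDiff
import Summits.ValiantsHypothesis.ValiantsHypothesis.Theorems.NewtonUnitEquationsTwoProductsAPTrinomial
import Summits.ValiantsHypothesis.ValiantsHypothesis.Theorems.NewtonUnitEquationsTwoProductsAPSupports

/-!
# Crux `TwoProducts` (stmt-5906), line `FrameRungTwo`: the symmetric-difference bound (SD) HOLDS for AP frames

The calibration certificate `…FrameRungTwoSymmDiff.lean` (p585202) reduced the line's open stub `stub_crossCancelCount` /
the rung `FrameRungTwo` at `k = 2` to the algebra-free statement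

  (SD)  `#vert conv(S_A ∆ S_B) ≤ (m t + 2)^C` for every pair of dissociated frames `A, B` (`m` coordinates, `≤ t` letters),

and named, as the place where a counterexample must live, pairs of 2-D DIGIT / mixed-radix frames.  This file closes that
door for all frames whose letter sets are ARITHMETIC PROGRESSIONS (`A_j ⊆ {a_j + i·d_j : i < t}` — every standard,
mixed-radix or twisted digit frame `u_j·{0,1,…,b−1}`): for such pairs (SD) holds with the explicit polynomial bound
`72 (m t + 1)²` (`symmDiff_apSupports_le`; three-term version `symmDiff_apTrinomial_le`: `72 (2m+1)²`).  Proof: by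
`support_allOnes` the symmetric difference is the support of the all-ones design `Π_j 𝟙_{A_j} − Π_j 𝟙_{B_j}`, a difference
of two products of AP-supported factors, to which the crux-level `twoProducts_apSupports` / `twoProducts_apTrinomial`
(each AP factor is a product of binomials over `ℂ`; `twoProducts_sparsity_le_two`) apply.  Consequently a refutation of
(SD), of the stub, or of the rung at `k = 2` must use letter triples that are NOT equally spaced collinear (uneven or
L-shaped digits).  Dissociation is used only to identify the support; the vertex bound itself needs none.  Honest scope:
calibration of one stub of a rung below the crux; nothing here bears on `VP ≠ VNP`. [ours; setting KPTT arXiv:1308.2286 §5]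
-/

set_option linter.dupNamespace false

namespace Summit.ValiantsHypothesis.ValiantsHypothesis.Theorems.NewtonFramesTwoProducts.FrameRungTwoSymmDiffAP

open MvPolynomial
open scoped BigOperators symmDiff
open Summit.ValiantsHypothesis.ValiantsHypothesis.Theorems.DissociatedFixedK.Negative (emb)
open Summit.ValiantsHypothesis.ValiantsHypothesis.Theorems.NewtonFramesTwoProducts.FrameRungTwoSymmDiff
  (support_sum_monomial_subset support_allOnes)

noncomputable section

/-- **(SD) for AP frames of any length.**  Two dissociated frames whose letter sets lie in arithmetic progressions
`{a_j + i·d_j : i < t}`: the convex hull of the symmetric difference of the two sumsets has `≤ 72 (m t + 1)²` vertices.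
[ours] -/
theorem symmDiff_apSupports_le (m t : ℕ) (A B : Fin m → Finset (Fin 2 →₀ ℕ))
    (hAap : ∀ j, ∃ a d : Fin 2 →₀ ℕ, A j ⊆ (Finset.range t).image (fun i : ℕ => a + i • d))
    (hBap : ∀ j, ∃ a d : Fin 2 →₀ ℕ, B j ⊆ (Finset.range t).image (fun i : ℕ => a + i • d))
    (hA : ∀ a b : Fin m → (Fin 2 →₀ ℕ), (∀ j, a j ∈ A j) → (∀ j, b j ∈ A j) → ∑ j, a j = ∑ j, b j → a = b)
    (hB : ∀ a b : Fin m → (Fin 2 →₀ ℕ), (∀ j, a j ∈ B j) → (∀ j, b j ∈ B j) → ∑ j, a j = ∑ j, b j → a = b) :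
    (Set.extremePoints ℝ (convexHull ℝ (emb ''
      ↑(((Fintype.piFinset A).image (fun a => ∑ j, a j)) ∆ ((Fintype.piFinset B).image (fun b => ∑ j, b j)))))).ncard
      ≤ 72 * (m * t + 1) ^ 2 := by
  classical
  rw [← support_allOnes A B hA hB]
  exact Summit.ValiantsHypothesis.ValiantsHypothesis.Theorems.TwoProducts.APSupports.twoProducts_apSupports m t
    (fun j => ∑ α ∈ A j, monomial α (1 : ℂ)) (fun j => ∑ β ∈ B j, monomial β (1 : ℂ))
    (fun j => by obtain ⟨a, d, h⟩ := hAap j; exact ⟨a, d, (support_sum_monomial_subset (A j)).trans h⟩)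
    (fun j => by obtain ⟨a, d, h⟩ := hBap j; exact ⟨a, d, (support_sum_monomial_subset (B j)).trans h⟩)

/-- **(SD) for AP-trinomial frames** (`t = 3`, letter triples in arithmetic progression `{a, a+d, a+2d}` — all base-3 /
mixed-radix digit frames `u_j·{0,1,2}`): `#vert conv(S_A ∆ S_B) ≤ 72 (2m+1)²`. [ours] -/
theorem symmDiff_apTrinomial_le (m : ℕ) (A B : Fin m → Finset (Fin 2 →₀ ℕ))
    (hAap : ∀ j, ∃ a d : Fin 2 →₀ ℕ, A j ⊆ {a, a + d, a + 2 • d})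
    (hBap : ∀ j, ∃ a d : Fin 2 →₀ ℕ, B j ⊆ {a, a + d, a + 2 • d})
    (hA : ∀ a b : Fin m → (Fin 2 →₀ ℕ), (∀ j, a j ∈ A j) → (∀ j, b j ∈ A j) → ∑ j, a j = ∑ j, b j → a = b)
    (hB : ∀ a b : Fin m → (Fin 2 →₀ ℕ), (∀ j, a j ∈ B j) → (∀ j, b j ∈ B j) → ∑ j, a j = ∑ j, b j → a = b) :
    (Set.extremePoints ℝ (convexHull ℝ (emb ''
      ↑(((Fintype.piFinset A).image (fun a => ∑ j, a j)) ∆ ((Fintype.piFinset B).image (fun b => ∑ j, b j)))))).ncard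
      ≤ 72 * (2 * m + 1) ^ 2 := by
  classical
  rw [← support_allOnes A B hA hB]
  exact Summit.ValiantsHypothesis.ValiantsHypothesis.Theorems.TwoProducts.APTrinomial.twoProducts_apTrinomial m
    (fun j => ∑ α ∈ A j, monomial α (1 : ℂ)) (fun j => ∑ β ∈ B j, monomial β (1 : ℂ))
    (fun j => by obtain ⟨a, d, h⟩ := hAap j; exact ⟨a, d, (support_sum_monomial_subset (A j)).trans h⟩)
    (fun j => by obtain ⟨a, d, h⟩ := hBap j; exact ⟨a, d, (support_sum_monomial_subset (B j)).trans h⟩)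

end

end Summit.ValiantsHypothesis.ValiantsHypothesis.Theorems.NewtonFramesTwoProducts.FrameRungTwoSymmDiffAP
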